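/-
Copyright (c) 2026. All rights reserved.
Released under Apache 2.0 license as described in the file LICENSE.
-/
import Literature.NumberTheory.Automorphic.BrandtModuleLevelInvolutionEigenspaces
import Mathlib.LinearAlgebra.Eigenspace.Pi
import Mathlib.LinearAlgebra.Eigenspace.Semisimple
import Mathlib.FieldTheory.Separable
import HarnessLib

/-!
# The sign-pattern decomposition of the Brandt module of an Eichler order under its local Atkin–Lehner involutions:
# `ℚ^{Cls O} = ⊕_χ M^χ(O)` (Martin 2018, §3.1, §3.3, §4; Voight (41.3.5))

[tag: quaternion_algebra] [tag: eichler_order] [tag: hecke_operator]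

Topic `NumberTheory/Automorphic`. Lane `lit-hodgefound`, seat p12, gen 52 — sequel of
`BrandtMatrixRamifiedEigenspaces.lean` / `BrandtModuleLevelInvolutionEigenspaces.lean` (ONE involution at a time:
`ℚ^{Cls O} = E₊ ⊕ E₋`) and of `EichlerOrdersAtkinLehnerGroup.lean` (all the involutions together, as a permutation action).

Let `O` be an Eichler order of level `N⁺` in the definite quaternion algebra of discriminant `N⁻` over `ℚ` (a Brandt setup
`S : XiSetup N⁺ N⁻`). At every `r ∈ ℕ` there is a LOCAL ATKIN–LEHNER INVOLUTION `W_r` of the class set `Cls O`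
(`XiSetup.atkinLehner`, §1): `W_r = W_{r⁻} : [I] ↦ [I 𝔓_r]` for a prime `r ∣ N⁻` (Martin's `σ_𝔭 : [x] ↦ [x ϖ_{B_𝔭}]`,
[Martin2018, §4.1]), `W_r = W_{r⁺} : [I] ↦ [I 𝔔_{r^e}]` for a prime `r ∤ N⁻` (`r^e ∥ N⁺`; the identity if `r ∤ N⁺`), and the
identity for non-prime `r`. They are pairwise commuting involutions preserving the type map and the entries of every Brandt
matrix. On the Brandt module `M(O) = ℚ^{Cls O}` (Martin's weight-zero quaternionic modular forms `M_0(O)`, on which the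
ramified Hecke operator is `(T_𝔭 φ)(x) = φ(x ϖ_{B_𝔭})`, a commuting family of involutions, [Martin2018, §3.1]) they act by
`φ ↦ φ ∘ W_r` (Mathlib `LinearMap.funLeft`).

For a finite set `T` of natural numbers (Martin's set `S` of primes, `𝔐 = ∏_{𝔭 ∈ S} 𝔭`) and a SIGN PATTERN `χ : T → {±1}`
([Martin2018, §3.3]: "a collection of signs `χ_𝔭 ∈ {±1}` for all `𝔭 ∣ 𝔐`") the SIGN SPACE (`XiSetup.signSpace`, §3) is

  `M^χ(O) = {φ : Cls O → ℚ | φ ∘ W_r = χ_r φ for all r ∈ T} = ⨅_{r ∈ T} E_{χ_r}(W_r)`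

([Martin2018, §3.3 and (4.2)–(4.3)]: `M_k^χ(O) = ⟨φ eigenform : T_𝔭 φ = χ_𝔭 φ for all 𝔭 ∣ 𝔐⟩`, and in weight zero
`φ ∈ M_0^χ(O) ⟺ φ(x_i) = χ_𝔭 φ(σ_𝔭(x_i))` for all `i` and all `𝔭 ∣ 𝔐`). Main results, for EVERY Brandt setup and every `T`:

* §1 `XiSetup.atkinLehner`: `atkinLehner_of_dvd/of_not_dvd/of_not_prime`, `atkinLehner_atkinLehner` (involution),
  `atkinLehner_comm`, `atkinLehner_eq_self_of_not_dvd_mul` (`r ∤ N⁺N⁻`), `typeOf_atkinLehner`, `weight_atkinLehner`,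
  `matrix_apply_atkinLehner_atkinLehner` (`T(n)_{W c, W c'} = T(n)_{c c'}`), `map_mulVec_comp_atkinLehner`;
* §2 on the Brandt module: `funLeft_atkinLehner_mul_self` (`W_r² = 1`), `commute_funLeft_atkinLehner`,
  **`commute_funLeft_atkinLehner_toLin_matrix`** (`W_r T(n) = T(n) W_r`), `mem_eigenspace_funLeft_atkinLehner_iff`,
  `maxGenEigenspace_funLeft_atkinLehner_eq_eigenspace` (involutions are semisimple),
  `eigenspace_funLeft_atkinLehner_eq_bot_of_ne` (spectrum `⊆ {±1}`);
* §3 `XiSetup.signSpace`: `mem_signSpace_iff`, **`iSupIndep_signSpace`**, **`iSup_signSpace_eq_top`**,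
  **`isInternal_signSpace`** (`ℚ^{Cls O} = ⊕_{χ : T → {±1}} M^χ(O)` — "`M_k(O)` has a basis of eigenforms as `(T_𝔭)_𝔭`
  is a commuting family of diagonalizable operators", [Martin2018, §3.1]), **`sum_finrank_signSpace`**
  (`∑_χ dim M^χ(O) = #Cls O`), **`mapsTo_toLin_matrix_signSpace`** (every `M^χ(O)` is a Hecke submodule),
  `mapsTo_funLeft_atkinLehner_signSpace`, `one_mem_signSpace_one` (`𝟙 ∈ M^{+_T}(O)`), `signSpace_one_ne_bot`,
  `signSpace_eq_bot_of_eq_neg_one` (`χ_r = −1` at some `r ∈ T` with `W_r = 1` kills the space),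
  `range_funLeft_typeOf_le_signSpace_one` and, when `T` contains every prime of `N⁺N⁻`,
  **`signSpace_one_eq_range_funLeft_typeOf`** (`M^{+_T}(O)` = the functions of the type) and
  **`finrank_signSpace_one`** (`dim M^{+_T}(O) = #Typ O`; [Martin2018, (3.8)–(3.9)]: `M_0^{+_𝔐}(O) ≃ {φ : Cl_𝔐(O) → ℂ}`,
  `h_{B,𝔐} = dim M_0^{+_𝔐}(O)`, with `Cl_𝔑(O)` = the type set [Martin2018, §2]).

## References

* [Martin2018] K. Martin, *Congruences for modular forms mod 2 and quaternionic `S`-ideal classes*, Canad. J. Math. 70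
  (2018) 1076–1095 (held: arXiv 1701.07864): §2 (`S`-ideal classes), §3.1 (`M_k(O)`, the ramified Hecke operators
  `T_𝔭 φ(x) = φ(x ϖ_{B_𝔭})` are commuting involutions and `M_k(O)` has a basis of eigenforms), §3.3 (sign patterns `χ`,
  the spaces `M_k^χ(O)`, (3.8)–(3.9)), §4.1–§4.2 (`σ_𝔭`, (4.2)–(4.3)).
* [Martin2018RefinedDimensions] K. Martin, *Refined dimensions of cusp forms, and equidistribution and bias of signs*,
  J. Number Theory 188 (2018) 1–17, §3 (sign patterns `ε_M` for the Atkin–Lehner operators, `S_k^{new, ε_M}(N)`).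
* [Voight2021] J. Voight, *Quaternion Algebras*, GTM 288 (2021): (41.3.5), Cor. 41.4.10, (23.4.20).
* [BertoliniDarmon1996] M. Bertolini, H. Darmon, *Heegner points on Mumford–Tate curves*, Invent. Math. 126 (1996), §1.5
  (the involutions `W_ℓ^±` of the definite Brandt module at the primes `ℓ ∣ N⁺N⁻`).
* [VignerasLNM800] M.-F. Vignéras, *Arithmétique des algèbres de quaternions*, LNM 800 (1980), Ch. III §5 exercice 5.8.

## Scope (honest)

Martin works with MAXIMAL orders over a totally real field of narrow class number one and the involutions `σ_𝔭` at the
ramified primes only; here `F = ℚ`, the order is an Eichler order of level `N⁺`, and the family of involutions also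
contains the level involutions `W_{p⁺}` (`p ∣ N⁺`) of [BertoliniDarmon1996, §1.5] — the linear algebra of commuting
involutions is the same. Only weight `k = 0` (the Brandt module `ℚ^{Cls O}`, rational instead of complex coefficients) is
treated. Two definitions (`XiSetup.atkinLehner`, `XiSetup.signSpace`), theorems otherwise; no named fact, no instance.
-/

noncomputable section

open scoped Pointwise Matrix

namespace Literature.NumberTheory.Automorphic

namespace Brandt

/-! ## §0 Commuting involutions of a type acting on functions (generic, private) -/

section Generic

variable {X : Type*} {σ τ : X → X}

/-- `(· ∘ σ)² = 1` for an involution `σ`. [folklore] -/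
private theorem funLeft_mul_self_of_involutive (hσ : Function.Involutive σ) :
    LinearMap.funLeft ℚ ℚ σ * LinearMap.funLeft ℚ ℚ σ = 1 := by
  ext v x
  simp [Module.End.mul_apply, LinearMap.funLeft_apply, hσ x]

/-- Commuting maps give commuting pull-backs. [folklore] -/
private theorem commute_funLeft_of_comm (h : ∀ x, σ (τ x) = τ (σ x)) :
    Commute (LinearMap.funLeft ℚ ℚ σ) (LinearMap.funLeft ℚ ℚ τ) := by
  change LinearMap.funLeft ℚ ℚ σ * LinearMap.funLeft ℚ ℚ τ = LinearMap.funLeft ℚ ℚ τ * LinearMap.funLeft ℚ ℚ σ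
  ext v x
  simp [Module.End.mul_apply, LinearMap.funLeft_apply, h x]

/-- `E_u(· ∘ σ) = {v : v ∘ σ = u v}` (`u = ±1`). [folklore] -/
private theorem mem_eigenspace_funLeft_iff (u : ℤˣ) (v : X → ℚ) :
    v ∈ Module.End.eigenspace (LinearMap.funLeft ℚ ℚ σ) ((u : ℤ) : ℚ) ↔ ∀ x, v (σ x) = ((u : ℤ) : ℚ) * v x := by
  rw [Module.End.mem_eigenspace_iff, funext_iff]
  simp only [LinearMap.funLeft_apply, Pi.smul_apply, smul_eq_mul]

/-- An involution of functions is a semisimple endomorphism (`X² − 1` is separable in characteristic `0`). [folklore] -/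
private theorem isSemisimple_funLeft_of_involutive (hσ : Function.Involutive σ) :
    Module.End.IsSemisimple (LinearMap.funLeft ℚ ℚ σ) := by
  refine Module.End.isSemisimple_of_squarefree_aeval_eq_zero (p := Polynomial.X ^ 2 - Polynomial.C (1 : ℚ)) ?_ ?_
  · exact (Polynomial.separable_X_pow_sub_C (1 : ℚ) (by norm_num) one_ne_zero).squarefree
  · rw [map_sub, map_pow, Polynomial.aeval_X, Polynomial.aeval_C, map_one, sq, funLeft_mul_self_of_involutive hσ, sub_self]

/-- For an involution, generalised eigenspaces are eigenspaces. [folklore] -/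
private theorem maxGenEigenspace_funLeft_eq_eigenspace [Finite X] (hσ : Function.Involutive σ) (μ : ℚ) :
    Module.End.maxGenEigenspace (LinearMap.funLeft ℚ ℚ σ) μ = Module.End.eigenspace (LinearMap.funLeft ℚ ℚ σ) μ :=
  (isSemisimple_funLeft_of_involutive hσ).isFinitelySemisimple.maxGenEigenspace_eq_eigenspace μ

/-- `E₊ ⊔ E₋ = ℚ^X` for an involution (`v = (v + v∘σ)/2 + (v − v∘σ)/2`). [folklore] -/
private theorem eigenspace_one_sup_eigenspace_neg_one_eq_top (hσ : Function.Involutive σ) :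
    Module.End.eigenspace (LinearMap.funLeft ℚ ℚ σ) 1 ⊔ Module.End.eigenspace (LinearMap.funLeft ℚ ℚ σ) (-1) = ⊤ := by
  rw [eq_top_iff]
  intro v _
  rw [Submodule.mem_sup]
  refine ⟨fun x => (v x + v (σ x)) / 2, ?_, fun x => (v x - v (σ x)) / 2, ?_, ?_⟩
  · rw [Module.End.mem_eigenspace_iff, one_smul, funext_iff]
    intro x
    simp only [LinearMap.funLeft_apply]
    rw [hσ x]; ring
  · rw [Module.End.mem_eigenspace_iff, funext_iff]
    intro x
    simp only [LinearMap.funLeft_apply, Pi.smul_apply, smul_eq_mul]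
    rw [hσ x]; ring
  · funext x
    show (v x + v (σ x)) / 2 + (v x - v (σ x)) / 2 = v x
    ring

/-- `⨆_μ (maximal generalised μ-eigenspace) = ℚ^X` for an involution. [folklore] -/
private theorem iSup_maxGenEigenspace_funLeft_eq_top [Finite X] (hσ : Function.Involutive σ) :
    ⨆ μ : ℚ, Module.End.maxGenEigenspace (LinearMap.funLeft ℚ ℚ σ) μ = ⊤ := by
  rw [eq_top_iff, ← eigenspace_one_sup_eigenspace_neg_one_eq_top hσ, sup_le_iff]
  constructor
  · exact (Module.End.eigenspace_le_maxGenEigenspace (f := LinearMap.funLeft ℚ ℚ σ) (μ := 1)).trans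
      (le_iSup (fun μ : ℚ => Module.End.maxGenEigenspace (LinearMap.funLeft ℚ ℚ σ) μ) 1)
  · exact (Module.End.eigenspace_le_maxGenEigenspace (f := LinearMap.funLeft ℚ ℚ σ) (μ := -1)).trans
      (le_iSup (fun μ : ℚ => Module.End.maxGenEigenspace (LinearMap.funLeft ℚ ℚ σ) μ) (-1))

/-- No eigenvalue other than `±1` for an involution. [folklore] -/
private theorem eigenspace_funLeft_eq_bot_of_ne (hσ : Function.Involutive σ) {μ : ℚ} (h1 : μ ≠ 1) (h2 : μ ≠ -1) :
    Module.End.eigenspace (LinearMap.funLeft ℚ ℚ σ) μ = ⊥ := by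
  rw [eq_bot_iff]
  intro v hv
  rw [Module.End.mem_eigenspace_iff, funext_iff] at hv
  simp only [LinearMap.funLeft_apply, Pi.smul_apply, smul_eq_mul] at hv
  rw [Submodule.mem_bot]
  funext x
  have e1 := hv x
  have e2 := hv (σ x)
  rw [hσ x] at e2
  have hμ : μ * μ - 1 ≠ 0 := by
    intro h0
    rcases mul_self_eq_one_iff.mp (by linarith : μ * μ = 1) with h | h
    · exact h1 h
    · exact h2 h
  have hv0 : (μ * μ - 1) * v x = 0 := by linear_combination (-μ) * e1 - e2
  rw [Pi.zero_apply]
  exact (mul_eq_zero.mp hv0).resolve_left hμ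

/-- The units of `ℤ`, cast to `ℚ`, are `±1`. [folklore] -/
private theorem units_cast_eq (u : ℤˣ) : ((u : ℤ) : ℚ) = 1 ∨ ((u : ℤ) : ℚ) = -1 := by
  rcases Int.units_eq_one_or u with h | h
  · exact Or.inl (by rw [h]; norm_num)
  · exact Or.inr (by rw [h]; norm_num)

/-- `χ ↦ (r ↦ (χ r : ℚ))` is injective on sign patterns. [folklore] -/
private theorem cast_comp_injective {ι : Type*} :
    Function.Injective fun (χ : ι → ℤˣ) (i : ι) => ((χ i : ℤ) : ℚ) := by
  intro χ χ' h
  funext i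
  have hi : ((χ i : ℤ) : ℚ) = ((χ' i : ℤ) : ℚ) := congrFun h i
  exact Units.ext (by exact_mod_cast hi)

variable {ι : Type*} {W : ι → X → X}

/-- **Simultaneous eigenspaces of commuting involutions are independent.** [folklore] -/
private theorem iSupIndep_iInf_eigenspace_funLeft (hc : ∀ i j x, W i (W j x) = W j (W i x)) :
    iSupIndep fun χ : ι → ℤˣ =>
      ⨅ i, Module.End.eigenspace (LinearMap.funLeft ℚ ℚ (W i)) ((χ i : ℤ) : ℚ) := by
  have hind := Module.End.independent_iInf_maxGenEigenspace_of_forall_mapsTo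
    (fun i => LinearMap.funLeft ℚ ℚ (W i))
    (fun i j φ => Module.End.mapsTo_maxGenEigenspace_of_comm (commute_funLeft_of_comm (hc j i)) φ)
  have hmono : iSupIndep fun χ : ι → ℚ => ⨅ i, Module.End.eigenspace (LinearMap.funLeft ℚ ℚ (W i)) (χ i) :=
    hind.mono fun χ => iInf_mono fun i => Module.End.eigenspace_le_maxGenEigenspace
  exact hmono.comp cast_comp_injective

/-- **Simultaneous eigenspaces of commuting involutions span** (finite `X`). [folklore] -/
private theorem iSup_iInf_eigenspace_funLeft_eq_top [Finite X] (hW : ∀ i, Function.Involutive (W i))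
    (hc : ∀ i j x, W i (W j x) = W j (W i x)) :
    ⨆ χ : ι → ℤˣ, ⨅ i, Module.End.eigenspace (LinearMap.funLeft ℚ ℚ (W i)) ((χ i : ℤ) : ℚ) = ⊤ := by
  classical
  have htop := Module.End.iSup_iInf_maxGenEigenspace_eq_top_of_forall_mapsTo
    (fun i => LinearMap.funLeft ℚ ℚ (W i))
    (fun i j φ => Module.End.mapsTo_maxGenEigenspace_of_comm (commute_funLeft_of_comm (hc j i)) φ)
    (fun i => iSup_maxGenEigenspace_funLeft_eq_top (hW i))
  rw [eq_top_iff, ← htop, iSup_le_iff]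
  intro μ
  by_cases hμ : ∀ i, μ i = 1 ∨ μ i = -1
  · -- `μ` is a genuine sign pattern
    let χ : ι → ℤˣ := fun i => if μ i = 1 then 1 else -1
    have hχ : ∀ i, ((χ i : ℤ) : ℚ) = μ i := fun i => by
      rcases hμ i with h | h
      · have e : χ i = 1 := if_pos h
        rw [e, h, Units.val_one, Int.cast_one]
      · have hne : ¬ μ i = 1 := by rw [h]; norm_num
        have e : χ i = -1 := if_neg hne
        rw [e, h, Units.val_neg, Units.val_one, Int.cast_neg, Int.cast_one]
    refine le_trans (le_of_eq ?_)
      (le_iSup (fun χ : ι → ℤˣ => ⨅ i, Module.End.eigenspace (LinearMap.funLeft ℚ ℚ (W i)) ((χ i : ℤ) : ℚ)) χ)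
    exact iInf_congr fun i => by rw [maxGenEigenspace_funLeft_eq_eigenspace (hW i), hχ i]
  · push Not at hμ
    obtain ⟨i, h1, h2⟩ := hμ
    refine le_trans (iInf_le _ i) ?_
    rw [maxGenEigenspace_funLeft_eq_eigenspace (hW i), eigenspace_funLeft_eq_bot_of_ne (hW i) h1 h2]
    exact bot_le

end Generic

/-! ## §1 The local Atkin–Lehner involutions `W_r` of `Cls O` -/

variable {Nplus Nminus : ℕ} (S : XiSetup Nplus Nminus)

/-- **The local Atkin–Lehner involution `W_r` of the class set of an Eichler order** (level `N⁺`, definite quaternion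
algebra of discriminant `N⁻` over `ℚ`) at `r ∈ ℕ`: for a prime `r ∣ N⁻` the ramified involution `W_{r⁻} : [I] ↦ [I 𝔓_r]`
(Martin's `σ_𝔭([x]) = [x ϖ_{B_𝔭}]`), for a prime `r ∤ N⁻` the level involution `W_{r⁺} : [I] ↦ [I 𝔔_{r^e}]`, `r^e ∥ N⁺`
(the identity if `r ∤ N⁺`), and the identity if `r` is not prime.
[cite: Martin2018, §4.1 (the involution `σ_𝔭` of `Cl(O)`)] [cite: BertoliniDarmon1996, §1.5 (the involutions `W_ℓ^±`)] -/
def XiSetup.atkinLehner (r : ℕ) : ClassSet S.O → ClassSet S.O :=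
  if hr : r.Prime then
    if h : r ∣ Nminus then @XiSetup.wMinus Nplus Nminus S r ⟨hr⟩ h else @XiSetup.wPlus Nplus Nminus S r ⟨hr⟩ h
  else id

/-- At a ramified prime `W_r = W_{r⁻}`. [cite: Martin2018, §4.1] -/
theorem XiSetup.atkinLehner_of_dvd {r : ℕ} [hr : Fact r.Prime] (h : r ∣ Nminus) : S.atkinLehner r = S.wMinus r h := by
  unfold XiSetup.atkinLehner
  rw [dif_pos hr.out, dif_pos h]

/-- At a prime `r ∤ N⁻`, `W_r = W_{r⁺}`. [cite: BertoliniDarmon1996, §1.5] -/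
theorem XiSetup.atkinLehner_of_not_dvd {r : ℕ} [hr : Fact r.Prime] (h : ¬ r ∣ Nminus) :
    S.atkinLehner r = S.wPlus r h := by
  unfold XiSetup.atkinLehner
  rw [dif_pos hr.out, dif_neg h]

/-- At a non-prime `r`, `W_r` is the identity. [cite: Martin2018, §4.1] -/
theorem XiSetup.atkinLehner_of_not_prime {r : ℕ} (h : ¬ r.Prime) : S.atkinLehner r = id := by
  unfold XiSetup.atkinLehner
  rw [dif_neg h]

/-- **`W_r` is the identity at every `r ∤ N⁺N⁻`** (`𝔔_1 = O`). [cite: Martin2018, §2 (`Cl_S(O)` for `S` a set of primes dividing `𝔑`)] [cite: Voight2021, (23.4.20)] -/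
theorem XiSetup.atkinLehner_eq_self_of_not_dvd_mul {r : ℕ} (h : ¬ r ∣ Nplus * Nminus) (c : ClassSet S.O) :
    S.atkinLehner r c = c := by
  by_cases hr : r.Prime
  · haveI : Fact r.Prime := ⟨hr⟩
    have hm : ¬ r ∣ Nminus := fun hd => h (hd.mul_left Nplus)
    have hp : ¬ r ∣ Nplus := fun hd => h (hd.mul_right Nminus)
    rw [S.atkinLehner_of_not_dvd hm, S.wPlus_eq_self_of_not_dvd hm hp]
  · rw [S.atkinLehner_of_not_prime hr, id_eq]

/-- **`W_r` is an involution** (`𝔓_r² = r O`, `𝔔² = r^e O`; Martin: `ϖ_{B_𝔭}² = ϖ_𝔭` is central).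
[cite: Martin2018, §4.1 ("a permutation of order 2")] [cite: BertoliniDarmon1996, §1.5] -/
theorem XiSetup.atkinLehner_atkinLehner (r : ℕ) (c : ClassSet S.O) : S.atkinLehner r (S.atkinLehner r c) = c := by
  by_cases hr : r.Prime
  · haveI : Fact r.Prime := ⟨hr⟩
    by_cases h : r ∣ Nminus
    · rw [S.atkinLehner_of_dvd h]; exact S.wMinus_wMinus h c
    · rw [S.atkinLehner_of_not_dvd h]; exact S.wPlus_wPlus h c
  · rw [S.atkinLehner_of_not_prime hr, id_eq, id_eq]

/-- `W_r` is involutive, as a `Function.Involutive` statement. [cite: Martin2018, §4.1] -/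
theorem XiSetup.involutive_atkinLehner (r : ℕ) : Function.Involutive (S.atkinLehner r) :=
  S.atkinLehner_atkinLehner r

/-- `W_r` is a permutation of `Cls O`. [cite: Martin2018, §4.1] -/
theorem XiSetup.bijective_atkinLehner (r : ℕ) : Function.Bijective (S.atkinLehner r) :=
  (S.involutive_atkinLehner r).bijective

/-- **The local involutions commute: `W_r W_{r'} = W_{r'} W_r`.** [cite: BertoliniDarmon1996, §1.5] [cite: VignerasLNM800, Ch. III §5 exercice 5.8 (d)] -/
theorem XiSetup.atkinLehner_comm (r r' : ℕ) (c : ClassSet S.O) :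
    S.atkinLehner r (S.atkinLehner r' c) = S.atkinLehner r' (S.atkinLehner r c) := by
  by_cases hr : r.Prime
  · haveI : Fact r.Prime := ⟨hr⟩
    by_cases hr' : r'.Prime
    · haveI : Fact r'.Prime := ⟨hr'⟩
      by_cases h : r ∣ Nminus <;> by_cases h' : r' ∣ Nminus
      · rw [S.atkinLehner_of_dvd h, S.atkinLehner_of_dvd h']; exact S.wMinus_comm h h' c
      · rw [S.atkinLehner_of_dvd h, S.atkinLehner_of_not_dvd h']; exact (S.wPlus_wMinus_comm h' h c).symm
      · rw [S.atkinLehner_of_not_dvd h, S.atkinLehner_of_dvd h']; exact S.wPlus_wMinus_comm h h' c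
      · rw [S.atkinLehner_of_not_dvd h, S.atkinLehner_of_not_dvd h']; exact S.wPlus_comm h h' c
    · rw [S.atkinLehner_of_not_prime hr', id_eq, id_eq]
  · rw [S.atkinLehner_of_not_prime hr, id_eq, id_eq]

/-- **`W_r` preserves the type**: `O_L(I 𝔓_r) ≅ O_L(I)`, `O_L(I 𝔔) ≅ O_L(I)` (Martin's Lemma 4: `O_l([x]) = O_l(σ_𝔭([x]))`).
[cite: Martin2018, §4.1 Lemma 4] -/
theorem XiSetup.typeOf_atkinLehner (r : ℕ) (c : ClassSet S.O) : typeOf S.O (S.atkinLehner r c) = typeOf S.O c := by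
  by_cases hr : r.Prime
  · haveI : Fact r.Prime := ⟨hr⟩
    by_cases h : r ∣ Nminus
    · rw [S.atkinLehner_of_dvd h]; exact S.typeOf_wMinus h c
    · rw [S.atkinLehner_of_not_dvd h]; exact S.typeOf_wPlus h c
  · rw [S.atkinLehner_of_not_prime hr, id_eq]

/-- `W_r` preserves the weight `w_c = #O_L(I_c)^×/2` (Martin's Lemma 4: `Γ([x]) = Γ(σ_𝔭([x]))`). [cite: Martin2018, §4.1 Lemma 4] -/
theorem XiSetup.weight_atkinLehner (r : ℕ) (c : ClassSet S.O) : weight S.O (S.atkinLehner r c) = weight S.O c :=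
  weight_eq_weight_of_typeOf_eq (S.typeOf_atkinLehner r c)

/-- **`T(n)_{W_r c, W_r c'} = T(n)_{c c'}` for every `n`.** [cite: BertoliniDarmon1996, §1.5] [cite: Voight2021, (41.3.5)] -/
theorem XiSetup.matrix_apply_atkinLehner_atkinLehner (r n : ℕ) (c c' : ClassSet S.O) :
    matrix S.O n (S.atkinLehner r c) (S.atkinLehner r c') = matrix S.O n c c' := by
  by_cases hr : r.Prime
  · haveI : Fact r.Prime := ⟨hr⟩
    by_cases h : r ∣ Nminus
    · rw [S.atkinLehner_of_dvd h]; exact S.matrix_apply_wMinus_wMinus h n c c'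
    · rw [S.atkinLehner_of_not_dvd h]; exact S.matrix_apply_wPlus_wPlus h n c c'
  · rw [S.atkinLehner_of_not_prime hr, id_eq, id_eq]

/-- `T(n) (v ∘ W_r) = (T(n) v) ∘ W_r` on `ℚ^{Cls O}`, every `n`. [cite: Voight2021, (41.3.5)] [cite: VignerasLNM800, Ch. III §5 exercice 5.8 (d)] -/
theorem XiSetup.map_mulVec_comp_atkinLehner [Fintype (ClassSet S.O)] (r n : ℕ) (v : ClassSet S.O → ℚ) :
    (matrix S.O n).map (Int.cast : ℤ → ℚ) *ᵥ (v ∘ S.atkinLehner r) =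
      ((matrix S.O n).map (Int.cast : ℤ → ℚ) *ᵥ v) ∘ S.atkinLehner r := by
  by_cases hr : r.Prime
  · haveI : Fact r.Prime := ⟨hr⟩
    by_cases h : r ∣ Nminus
    · rw [S.atkinLehner_of_dvd h]; exact S.map_mulVec_comp_wMinus h n v
    · rw [S.atkinLehner_of_not_dvd h]; exact S.map_mulVec_comp_wPlus h n v
  · rw [S.atkinLehner_of_not_prime hr, Function.comp_id, Function.comp_id]

/-! ## §2 The local involutions on the Brandt module `ℚ^{Cls O}` -/

/-- **`W_r² = 1` on the Brandt module** (Martin: `T_𝔭` acts on `M_k(O)` with order `2`). [cite: Martin2018, §3.1] -/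
theorem XiSetup.funLeft_atkinLehner_mul_self (r : ℕ) :
    LinearMap.funLeft ℚ ℚ (S.atkinLehner r) * LinearMap.funLeft ℚ ℚ (S.atkinLehner r) = 1 :=
  funLeft_mul_self_of_involutive (S.involutive_atkinLehner r)

/-- **The operators `W_r` on the Brandt module commute** ("a commuting family of diagonalizable operators"). [cite: Martin2018, §3.1] -/
theorem XiSetup.commute_funLeft_atkinLehner (r r' : ℕ) :
    Commute (LinearMap.funLeft ℚ ℚ (S.atkinLehner r)) (LinearMap.funLeft ℚ ℚ (S.atkinLehner r')) :=
  commute_funLeft_of_comm fun c => S.atkinLehner_comm r r' c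

/-- **`W_r` commutes with every Brandt matrix `T(n)` on `ℚ^{Cls O}`.** [cite: Voight2021, (41.3.5)] [cite: BertoliniDarmon1996, §1.5] -/
theorem XiSetup.commute_funLeft_atkinLehner_toLin_matrix [Fintype (ClassSet S.O)] [DecidableEq (ClassSet S.O)] (r n : ℕ) :
    Commute (LinearMap.funLeft ℚ ℚ (S.atkinLehner r)) (Matrix.toLin' ((matrix S.O n).map (Int.cast : ℤ → ℚ))) := by
  change LinearMap.funLeft ℚ ℚ (S.atkinLehner r) * Matrix.toLin' _ = Matrix.toLin' _ * LinearMap.funLeft ℚ ℚ (S.atkinLehner r)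
  apply LinearMap.ext
  intro v
  rw [Module.End.mul_apply, Module.End.mul_apply, Matrix.toLin'_apply, Matrix.toLin'_apply]
  change ((matrix S.O n).map (Int.cast : ℤ → ℚ) *ᵥ v) ∘ S.atkinLehner r =
    (matrix S.O n).map (Int.cast : ℤ → ℚ) *ᵥ (v ∘ S.atkinLehner r)
  rw [S.map_mulVec_comp_atkinLehner r n v]

/-- `E_u(W_r) = {v : v ∘ W_r = u v}` for a sign `u = ±1` (Martin (4.3): `φ(x_i) = χ_𝔭 φ(σ_𝔭(x_i))`). [cite: Martin2018, §4.2 (4.3)] -/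
theorem XiSetup.mem_eigenspace_funLeft_atkinLehner_iff (r : ℕ) (u : ℤˣ) (v : ClassSet S.O → ℚ) :
    v ∈ Module.End.eigenspace (LinearMap.funLeft ℚ ℚ (S.atkinLehner r)) ((u : ℤ) : ℚ) ↔
      ∀ c, v (S.atkinLehner r c) = ((u : ℤ) : ℚ) * v c :=
  mem_eigenspace_funLeft_iff u v

/-- **`W_r` is diagonalizable**: its generalised eigenspaces are eigenspaces ("the diagonalizability of the ramified Hecke
operators `T_𝔭` follows from the fact that they are involutions"). [cite: Martin2018, §3.1] -/
theorem XiSetup.maxGenEigenspace_funLeft_atkinLehner_eq_eigenspace (r : ℕ) (μ : ℚ) :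
    Module.End.maxGenEigenspace (LinearMap.funLeft ℚ ℚ (S.atkinLehner r)) μ =
      Module.End.eigenspace (LinearMap.funLeft ℚ ℚ (S.atkinLehner r)) μ :=
  maxGenEigenspace_funLeft_eq_eigenspace (S.involutive_atkinLehner r) μ

/-- `W_r` has no eigenvalue outside `{1, −1}`. [cite: Martin2018, §3.1] [cite: Voight2021, (41.3.5)] -/
theorem XiSetup.eigenspace_funLeft_atkinLehner_eq_bot_of_ne (r : ℕ) {μ : ℚ} (h1 : μ ≠ 1) (h2 : μ ≠ -1) :
    Module.End.eigenspace (LinearMap.funLeft ℚ ℚ (S.atkinLehner r)) μ = ⊥ :=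
  eigenspace_funLeft_eq_bot_of_ne (S.involutive_atkinLehner r) h1 h2

/-- `ℚ^{Cls O} = E₊(W_r) ⊔ E₋(W_r)`. [cite: Martin2018, §4.2 (`V ≃ V^{+_𝔭} ⊕ V^{-_𝔭}`)] -/
theorem XiSetup.eigenspace_funLeft_atkinLehner_one_sup_neg_one (r : ℕ) :
    Module.End.eigenspace (LinearMap.funLeft ℚ ℚ (S.atkinLehner r)) 1 ⊔
      Module.End.eigenspace (LinearMap.funLeft ℚ ℚ (S.atkinLehner r)) (-1) = ⊤ :=
  eigenspace_one_sup_eigenspace_neg_one_eq_top (S.involutive_atkinLehner r)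

/-- At `r ∤ N⁺N⁻` the operator `W_r` is the identity: `E₊(W_r) = ℚ^{Cls O}`. [cite: Voight2021, (23.4.20)] -/
theorem XiSetup.eigenspace_funLeft_atkinLehner_one_eq_top_of_not_dvd_mul {r : ℕ} (h : ¬ r ∣ Nplus * Nminus) :
    Module.End.eigenspace (LinearMap.funLeft ℚ ℚ (S.atkinLehner r)) 1 = ⊤ := by
  rw [eq_top_iff]
  intro v _
  rw [Module.End.mem_eigenspace_iff, one_smul]
  funext c
  rw [LinearMap.funLeft_apply, S.atkinLehner_eq_self_of_not_dvd_mul h]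

/-- At `r ∤ N⁺N⁻`, `E₋(W_r) = 0`. [cite: Voight2021, (23.4.20)] -/
theorem XiSetup.eigenspace_funLeft_atkinLehner_neg_one_eq_bot_of_not_dvd_mul {r : ℕ} (h : ¬ r ∣ Nplus * Nminus) :
    Module.End.eigenspace (LinearMap.funLeft ℚ ℚ (S.atkinLehner r)) (-1) = ⊥ := by
  rw [eq_bot_iff]
  intro v hv
  rw [Module.End.mem_eigenspace_iff, funext_iff] at hv
  rw [Submodule.mem_bot]
  funext c
  have hc := hv c
  rw [LinearMap.funLeft_apply, S.atkinLehner_eq_self_of_not_dvd_mul h, Pi.smul_apply, smul_eq_mul, neg_one_mul] at hc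
  rw [Pi.zero_apply]
  linarith

/-! ## §3 Sign patterns and the sign spaces `M^χ(O)` -/

/-- **Martin's space `M^χ(O)` of weight-zero quaternionic modular forms with sign pattern `χ`**: for a finite set `T` of
natural numbers (the primes `𝔭 ∣ 𝔐`) and a collection of signs `χ_r ∈ {±1}`, `r ∈ T`, the functions `φ : Cls O → ℚ` with
`φ ∘ W_r = χ_r φ` for every `r ∈ T` — the joint eigenspace `⨅_{r ∈ T} E_{χ_r}(W_r)` of the local Atkin–Lehner involutions.
[cite: Martin2018, §3.3 (`M_k^χ(O)`) and §4.2 (4.3)] [cite: Martin2018RefinedDimensions, §3 (sign patterns `ε_M`)] -/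
def XiSetup.signSpace (T : Finset ℕ) (χ : T → ℤˣ) : Submodule ℚ (ClassSet S.O → ℚ) :=
  ⨅ r : T, Module.End.eigenspace (LinearMap.funLeft ℚ ℚ (S.atkinLehner r)) ((χ r : ℤ) : ℚ)

variable (T : Finset ℕ)

/-- Unfolding `M^χ(O)`. [cite: Martin2018, §3.3] -/
theorem XiSetup.signSpace_eq (χ : T → ℤˣ) :
    S.signSpace T χ = ⨅ r : T, Module.End.eigenspace (LinearMap.funLeft ℚ ℚ (S.atkinLehner r)) ((χ r : ℤ) : ℚ) :=
  rfl

/-- **`φ ∈ M^χ(O) ⟺ φ(W_r c) = χ_r φ(c)` for all `r ∈ T` and all classes `c`** (Martin's (4.3)). [cite: Martin2018, §4.2 (4.3)] -/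
theorem XiSetup.mem_signSpace_iff (χ : T → ℤˣ) (v : ClassSet S.O → ℚ) :
    v ∈ S.signSpace T χ ↔ ∀ (r : T) (c : ClassSet S.O), v (S.atkinLehner r c) = ((χ r : ℤ) : ℚ) * v c := by
  rw [XiSetup.signSpace, Submodule.mem_iInf]
  exact forall_congr' fun r => S.mem_eigenspace_funLeft_atkinLehner_iff r (χ r) v

/-- `M^χ(O) ≤ E_{χ_r}(W_r)` for each `r ∈ T`. [cite: Martin2018, §3.3] -/
theorem XiSetup.signSpace_le_eigenspace (χ : T → ℤˣ) (r : T) :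
    S.signSpace T χ ≤ Module.End.eigenspace (LinearMap.funLeft ℚ ℚ (S.atkinLehner r)) ((χ r : ℤ) : ℚ) :=
  iInf_le _ r

/-- With no condition (`T = ∅`) the sign space is everything. [cite: Martin2018, §2 (`S = ∅`)] -/
theorem XiSetup.signSpace_empty (χ : (∅ : Finset ℕ) → ℤˣ) : S.signSpace ∅ χ = ⊤ := by
  rw [XiSetup.signSpace]
  haveI : IsEmpty ((∅ : Finset ℕ) : Set ℕ) := by simp
  exact iInf_of_empty _

/-- **THE SIGN SPACES ARE INDEPENDENT**: `M^χ(O) ∩ ∑_{χ' ≠ χ} M^{χ'}(O) = 0`. [cite: Martin2018, §3.1 and §3.3] -/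
theorem XiSetup.iSupIndep_signSpace : iSupIndep (S.signSpace T) :=
  iSupIndep_iInf_eigenspace_funLeft (W := fun r : T => S.atkinLehner r) fun r r' c => S.atkinLehner_comm r r' c

/-- **THE SIGN SPACES SPAN**: `∑_χ M^χ(O) = ℚ^{Cls O}` ("`M_k(O)` has a basis of eigenforms as `(T_𝔭)_𝔭` is a commuting
family of diagonalizable operators"). [cite: Martin2018, §3.1] -/
theorem XiSetup.iSup_signSpace_eq_top : ⨆ χ : T → ℤˣ, S.signSpace T χ = ⊤ :=
  iSup_iInf_eigenspace_funLeft_eq_top (W := fun r : T => S.atkinLehner r) (fun r => S.involutive_atkinLehner r)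
    fun r r' c => S.atkinLehner_comm r r' c

/-- **THE SIGN-PATTERN DECOMPOSITION OF THE BRANDT MODULE: `ℚ^{Cls O} = ⊕_{χ : T → {±1}} M^χ(O)`** for every Eichler
order of a definite quaternion algebra over `ℚ` and every finite set `T` (Martin: `M_k(O)` has a basis of simultaneous
eigenforms of the commuting involutions `T_𝔭`; each eigenform has a sign pattern). [cite: Martin2018, §3.1 and §3.3] [cite: Voight2021, (41.3.5)] -/
theorem XiSetup.isInternal_signSpace : DirectSum.IsInternal (S.signSpace T) :=
  DirectSum.isInternal_submodule_of_iSupIndep_of_iSup_eq_top (S.iSupIndep_signSpace T) (S.iSup_signSpace_eq_top T)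

/-- Distinct sign patterns give disjoint sign spaces. [cite: Martin2018, §3.3] -/
theorem XiSetup.disjoint_signSpace {χ χ' : T → ℤˣ} (h : χ ≠ χ') : Disjoint (S.signSpace T χ) (S.signSpace T χ') :=
  (S.iSupIndep_signSpace T).pairwiseDisjoint h

/-- **`∑_χ dim M^χ(O) = #Cls O`** (the class number). [cite: Martin2018, §3.3 and §4.2 (proof of Lemma 5: `dim A(+_𝔭) + dim A(−_𝔭) = dim M_k(O)`)] -/
theorem XiSetup.sum_finrank_signSpace :
    ∑ χ : T → ℤˣ, Module.finrank ℚ (S.signSpace T χ) = Nat.card (ClassSet S.O) := by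
  classical
  haveI : Fintype (ClassSet S.O) := Fintype.ofFinite _
  have e := LinearEquiv.ofBijective (DirectSum.coeLinearMap (S.signSpace T)) (S.isInternal_signSpace T)
  rw [← Module.finrank_directSum, e.finrank_eq, Module.finrank_fintype_fun_eq_card, Nat.card_eq_fintype_card]

/-- Every `W_{r'}` maps each `M^χ(O)` into itself. [cite: Martin2018, §3.1] -/
theorem XiSetup.mapsTo_funLeft_atkinLehner_signSpace (χ : T → ℤˣ) (r' : ℕ) :
    Set.MapsTo (LinearMap.funLeft ℚ ℚ (S.atkinLehner r')) (S.signSpace T χ) (S.signSpace T χ) := by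
  intro v hv
  rw [SetLike.mem_coe, XiSetup.signSpace, Submodule.mem_iInf] at hv ⊢
  exact fun r => Module.End.mapsTo_genEigenspace_of_comm (S.commute_funLeft_atkinLehner r' r).symm _ 1 (hv r)

/-- **EVERY SIGN SPACE `M^χ(O)` IS A HECKE SUBMODULE**: each Brandt matrix `T(n)` maps it into itself.
[cite: Martin2018, §3.3 (`M_k^χ(O)` is spanned by eigenforms)] [cite: Voight2021, Cor. 41.4.10] -/
theorem XiSetup.mapsTo_toLin_matrix_signSpace [Fintype (ClassSet S.O)] [DecidableEq (ClassSet S.O)] (χ : T → ℤˣ) (n : ℕ) :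
    Set.MapsTo (Matrix.toLin' ((matrix S.O n).map (Int.cast : ℤ → ℚ))) (S.signSpace T χ) (S.signSpace T χ) := by
  intro v hv
  rw [SetLike.mem_coe, XiSetup.signSpace, Submodule.mem_iInf] at hv ⊢
  exact fun r => Module.End.mapsTo_genEigenspace_of_comm (S.commute_funLeft_atkinLehner_toLin_matrix r n) _ 1 (hv r)

/-- `T(n) v ∈ M^χ(O)` for `v ∈ M^χ(O)` (matrix form). [cite: Voight2021, Cor. 41.4.10] -/
theorem XiSetup.mulVec_mem_signSpace [Fintype (ClassSet S.O)] (χ : T → ℤˣ) (n : ℕ) {v : ClassSet S.O → ℚ}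
    (hv : v ∈ S.signSpace T χ) : (matrix S.O n).map (Int.cast : ℤ → ℚ) *ᵥ v ∈ S.signSpace T χ := by
  classical
  have h := S.mapsTo_toLin_matrix_signSpace T χ n hv
  rwa [SetLike.mem_coe, Matrix.toLin'_apply] at h

/-- **The constant function lies in `M^{+_T}(O)`** (Martin: `M_0^{+_𝔐}(O) = S_0^{+_𝔐}(O) ⊕ ℂ𝟙`). [cite: Martin2018, §3.3] -/
theorem XiSetup.one_mem_signSpace_one : (fun _ => (1 : ℚ)) ∈ S.signSpace T 1 := by
  rw [S.mem_signSpace_iff]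
  intro r c
  simp

/-- `M^{+_T}(O) ≠ 0`. [cite: Martin2018, §3.3] -/
theorem XiSetup.signSpace_one_ne_bot : S.signSpace T 1 ≠ ⊥ := by
  intro h
  have h1 := S.one_mem_signSpace_one T
  rw [h, Submodule.mem_bot, funext_iff] at h1
  haveI : Nonempty (ClassSet S.O) := ⟨Quotient.mk _ ⟨S.O, S.self_mem_rightIdeals⟩⟩
  exact one_ne_zero (h1 (Classical.arbitrary _))

/-- **A sign `χ_r = −1` at some `r ∈ T` with `r ∤ N⁺N⁻` kills the sign space** (`W_r = 1` there). [cite: Martin2018, §2 and §3.3] [cite: Voight2021, (23.4.20)] -/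
theorem XiSetup.signSpace_eq_bot_of_eq_neg_one (χ : T → ℤˣ) {r : T} (hr : ¬ (r : ℕ) ∣ Nplus * Nminus) (hχ : χ r = -1) :
    S.signSpace T χ = ⊥ := by
  rw [eq_bot_iff]
  refine le_trans (S.signSpace_le_eigenspace T χ r) (le_of_eq ?_)
  rw [hχ, Units.val_neg, Units.val_one, Int.cast_neg, Int.cast_one]
  exact S.eigenspace_funLeft_atkinLehner_neg_one_eq_bot_of_not_dvd_mul hr

/-- Enlarging `T` by conditions shrinks the sign space: `M^{χ}(O)` for `T'` lies in `M^{χ|_T}(O)` for `T ⊆ T'`. [cite: Martin2018, §3.3] -/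
theorem XiSetup.signSpace_le_signSpace_of_subset {T T' : Finset ℕ} (h : T ⊆ T') (χ : T' → ℤˣ) :
    S.signSpace T' χ ≤ S.signSpace T fun r => χ ⟨r, h r.2⟩ := by
  intro v hv
  rw [S.mem_signSpace_iff] at hv ⊢
  exact fun r c => hv ⟨r, h r.2⟩ c

/-- **The functions of the type lie in `M^{+_T}(O)`** for every `T`. [cite: Martin2018, §4.1 Lemma 4 and (3.8)] -/
theorem XiSetup.range_funLeft_typeOf_le_signSpace_one :
    LinearMap.range (LinearMap.funLeft ℚ ℚ (typeOf S.O)) ≤ S.signSpace T 1 := by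
  rintro v ⟨g, rfl⟩
  rw [S.mem_signSpace_iff]
  intro r c
  rw [Pi.one_apply, Units.val_one, Int.cast_one, one_mul]
  exact congrArg g (S.typeOf_atkinLehner r c)

/-- **`φ ∈ M^{+_T}(O)` iff `φ` is a function of the type, when `T` contains every prime of `N⁺N⁻`** (Martin (3.8):
`M_0^{+_𝔐}(O) ≃ {φ : Cl_𝔐(O) → ℂ}`, with `Cl_𝔑(O)` the set of types, §2). [cite: Martin2018, §2 and (3.8)] [cite: Voight2021, Prop. 18.5.10 and (23.4.20)] -/
theorem XiSetup.mem_signSpace_one_iff_exists_comp_typeOf (hT : (Nplus * Nminus).primeFactors ⊆ T) (v : ClassSet S.O → ℚ) :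
    v ∈ S.signSpace T 1 ↔ ∃ g : TypeSet S.O → ℚ, v = g ∘ typeOf S.O := by
  rw [← S.atkinLehnerInvariant_iff_exists_comp_typeOf, S.mem_signSpace_iff]
  have hN0 : Nplus * Nminus ≠ 0 := mul_ne_zero S.nplus_ne_zero S.squarefree.ne_zero
  constructor
  · intro h
    refine ⟨fun q hf hq c => ?_, fun p hf hp c => ?_⟩
    · have hm : q ∈ T := hT (Nat.mem_primeFactors.mpr ⟨hf.out, hq.mul_left Nplus, hN0⟩)
      have e := h ⟨q, hm⟩ c
      rw [Pi.one_apply, Units.val_one, Int.cast_one, one_mul] at e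
      rwa [S.atkinLehner_of_dvd hq] at e
    · by_cases hpN : p ∣ Nplus
      · have hm : p ∈ T := hT (Nat.mem_primeFactors.mpr ⟨hf.out, hpN.mul_right Nminus, hN0⟩)
        have e := h ⟨p, hm⟩ c
        rw [Pi.one_apply, Units.val_one, Int.cast_one, one_mul] at e
        rwa [S.atkinLehner_of_not_dvd hp] at e
      · rw [S.wPlus_eq_self_of_not_dvd hp hpN]
  · rintro ⟨hM, hP⟩ r c
    rw [Pi.one_apply, Units.val_one, Int.cast_one, one_mul]
    by_cases hr : (r : ℕ).Prime
    · haveI : Fact (r : ℕ).Prime := ⟨hr⟩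
      by_cases h : (r : ℕ) ∣ Nminus
      · rw [S.atkinLehner_of_dvd h]; exact hM r inferInstance h c
      · rw [S.atkinLehner_of_not_dvd h]; exact hP r inferInstance h c
    · rw [S.atkinLehner_of_not_prime hr, id_eq]

/-- **`M^{+_T}(O)` = the functions of the type** (as a submodule), `T ⊇` primes of `N⁺N⁻`. [cite: Martin2018, §2 and (3.8)] [cite: Voight2021, Prop. 18.5.10] -/
theorem XiSetup.signSpace_one_eq_range_funLeft_typeOf (hT : (Nplus * Nminus).primeFactors ⊆ T) :
    S.signSpace T 1 = LinearMap.range (LinearMap.funLeft ℚ ℚ (typeOf S.O)) := by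
  ext v
  rw [S.mem_signSpace_one_iff_exists_comp_typeOf T hT, LinearMap.mem_range]
  constructor
  · rintro ⟨g, rfl⟩; exact ⟨g, rfl⟩
  · rintro ⟨g, rfl⟩; exact ⟨g, rfl⟩

/-- **`dim M^{+_T}(O) = #Typ O` (the type number) when `T` contains every prime of `N⁺N⁻`** (Martin (3.9):
`h_{B,𝔐} = dim M_0^{+_𝔐}(O)`, and `h_{B,𝔑} = t_B`). [cite: Martin2018, §2 and (3.9)] [cite: Voight2021, Cor. 18.5.12] -/
theorem XiSetup.finrank_signSpace_one (hT : (Nplus * Nminus).primeFactors ⊆ T) :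
    Module.finrank ℚ (S.signSpace T 1) = Nat.card (TypeSet S.O) := by
  rw [S.signSpace_one_eq_range_funLeft_typeOf T hT, S.finrank_range_funLeft_typeOf]

/-- **`∑_{χ ≠ +_T} dim M^χ(O) = #Cls O − #Typ O`** when `T` contains every prime of `N⁺N⁻`. [cite: Martin2018, §2 and §3.3] [cite: Voight2021, Cor. 18.5.12] -/
theorem XiSetup.sum_finrank_signSpace_ne_one (hT : (Nplus * Nminus).primeFactors ⊆ T) :
    ∑ χ ∈ (Finset.univ : Finset (T → ℤˣ)).erase 1, Module.finrank ℚ (S.signSpace T χ) =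
      Nat.card (ClassSet S.O) - Nat.card (TypeSet S.O) := by
  classical
  have h := S.sum_finrank_signSpace T
  rw [← Finset.add_sum_erase _ _ (Finset.mem_univ (1 : T → ℤˣ)), S.finrank_signSpace_one T hT] at h
  omega

/-- A single condition: `M^{χ}(O)` for `T = {r}` is the eigenspace `E_{χ_r}(W_r)`. [cite: Martin2018, §4.3 (4.4)] -/
theorem XiSetup.signSpace_singleton (r : ℕ) (χ : ({r} : Finset ℕ) → ℤˣ) :
    S.signSpace {r} χ =
      Module.End.eigenspace (LinearMap.funLeft ℚ ℚ (S.atkinLehner r)) ((χ ⟨r, Finset.mem_singleton_self r⟩ : ℤ) : ℚ) := by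
  apply le_antisymm
  · exact S.signSpace_le_eigenspace {r} χ ⟨r, Finset.mem_singleton_self r⟩
  · rw [XiSetup.signSpace, le_iInf_iff]
    rintro ⟨r', hr'⟩
    have e : r' = r := Finset.mem_singleton.mp hr'
    subst e
    exact le_rfl

end Brandt

end Literature.NumberTheory.Automorphic
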